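import Mathlib.RingTheory.MvPolynomial.Symmetric.FundamentalTheorem
import Mathlib.RingTheory.MvPolynomial.Homogeneous
import Mathlib.RingTheory.Polynomial.Vieta
import Mathlib.Algebra.Polynomial.Taylor
import HarnessLib

/-!
# Villamayor 2007, §1: the universal monic polynomial and the UNIVERSAL ELIMINATION ALGEBRA `R̄_b`
# (and its multi-polynomial version `R̄_{c₁,…,c_r}`), as real definitions

O. E. Villamayor U., *Hypersurface singularities in positive characteristic*, Adv. Math. **213** (2007)
687–733 = arXiv:math/0606796 [Villamayor2007]. Locators «p00NN Lnn» are chunk · line of the held arXiv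
text (`lit read paper:arxiv-math_0606796`, chunks p0006–p0014 re-read before typing); printed item
numbers (§1.5, Remark 1.6, 1.11, 1.15, 1.24–1.25, Def. 1.42) are those of the arXiv version.
Campaign `res-hironaka` (D-0089), ladder rung LIT-6 (Villamayor 2007/2008 and Bravo–Villamayor as a
comparison programme for §§3–4 of the 2017 manuscript). This is a VOCABULARY file: real Lean
definitions over Mathlib's symmetric-polynomial API with elementary API PROVED; NO named facts are
introduced; nothing of Hironaka's 2017 manuscript is referred to or asserted. The SPECIALIZATION
`R̄_b → S` («from universal to concrete», Def. 1.42) and the Rees algebra `⊕ I_r W^r ⊂ S[W]` it generates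
are the sibling file `EliminationAlgebra.lean`.

Consumers of record that name this carrier gap: `Resolution/BenitoVillamayor2013Cleaning.lean` («the
tree has no elimination algebras … so `ℛ_{𝒢,β}` cannot be named»), the campaign files
`Summits/…/Theorems/MarkedTransferCampaignW14ElimAlgebra.lean` (W1.4, «`R_{G,β}` … is NOT constructed
here») and `Summits/…/Theorems/Rescue/RR139EliminationCoreFocus.lean` (rescue row RR-139: «Villamayor's
β-elimination algebra has no tree carrier»). What the tree ALREADY has and is not repeated:
`Resolution/PointBlowupElimination.lean` (a generator-level READING of `ℛ_{𝒢,β}` for the purely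
inseparable `x^q + F(y)` on the point-blow-up walk: `freshGens` = Hasse–Schmidt derivatives of `F`),
`Resolution/Eliminations.lean` (Cossart–Jannsen–Saito `ν`- and `Σ^max`-eliminations — a different notion),
and Mathlib's symmetric-function theory (`symmetricSubalgebra`, `esymm`, `esymmAlgEquiv`).

## What is typed (§1 of the source, p0006 L7 – p0014 L71), and how

* **§1.5, p0007 L1–L16: the universal monic polynomial.** «`F_b(Z) = (Z − Y₁)(Z − Y₂)⋯(Z − Y_b) ∈
  k[Y₁,…,Y_b][Z]` … `F_b(Z) = Z^b − s_{b,1} Z^{b−1} + … + (−1)^b s_{b,b} ∈ R_b[Z]`», `R_b = k[Y]^{𝕊_b} =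
  k[s_{b,1},…,s_{b,b}]` the symmetric polynomials (Mathlib `MvPolynomial.symmetricSubalgebra`,
  `MvPolynomial.esymm`; the freeness of `R_b` on the `s_{b,i}` is Mathlib's `MvPolynomial.esymmAlgEquiv`).
  Typed for any finite index type `ι` («`b = #ι`») and any commutative ring `k` (p0006 L111–L113: «to
  some extent the form of elimination we discuss here works over arbitrary rings»): `univMonic ι k`;
  PROVED `univMonic_monic`, `natDegree_univMonic`, and the Vieta expansion `coeff_univMonic`
  (`coeff_k F_b = (−1)^{b−k} s_{b,b−k}`).
* **Def. 1.2, p0006 L54–L65: `Tay` and the operators `Δ^r`.** «`Tay(F(Z)) = F(Z+T) = Σ Δ^r(F(Z)) T^r`» —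
  these are Mathlib's `Polynomial.taylor` and the Hasse derivatives `Polynomial.hasseDeriv r`
  (`Polynomial.taylor_coeff : (taylor r f).coeff n = (hasseDeriv n f).eval r`); we only name
  `deltaOp r := Polynomial.hasseDeriv r` with the two printed sanity values (`Δ^n(Z^n) = 1`,
  `Δ^r(Z^n) = 0` for `r > n`) PROVED, and `univMonicDelta e := Δ^e(F_b)` (p0008 L21–L27).
* **p0007 L18–L23 / 1.24–1.25, p0011 L4–L25: permutation groups acting on `k[Y]`.** For a subgroup
  `G ≤ 𝕊_ι` the invariant subalgebra `permInvariant G = {p ; σ·p = p ∀ σ ∈ G}` (`σ·p = rename σ p`);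
  `permInvariant ⊤ = symmetricSubalgebra` (`permInvariant_top`). The product `𝕊_{c₁} × ⋯ × 𝕊_{c_r} ⊂ 𝕊_b`
  of 1.24–1.25 («identify `k[Y^{(1)}_1,…,Y^{(r)}_{c_r}]` with `k[Y₁,…,Y_b]`») is the subgroup `blockPerm blk`
  of permutations preserving a block map `blk : ι → β` (one block `β = Unit` gives all of `𝕊_ι`:
  `blockPerm_const`).
* **p0007 L42–L55 / (1.25.1) p0011 L27–L34: the algebra of differences.** «the subring
  `k[Y₂ − Y₁, …, Y_b − Y₁] = k[Z_{i,j}]` where `Z_{i,j} = Y_i − Y_j`» = `diffSubalgebra ι k :=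
  Algebra.adjoin k {Y_i − Y_j}` (= `A_{c₁,…,c_r}` of (1.25.1), which is the same ring); PROVED: it is
  stable under every permutation (`rename_mem_diffSubalgebra`) and GRADED, i.e. closed under taking
  homogeneous components (`homogeneousComponent_mem_diffSubalgebra`; p0008 L68–L72 «graded as subring of
  `k[Y₁,…,Y_b]` with the usual grade», p0011 L36 «in a way that preserves the usual degrees»).
* **(1.5.2) p0007 L49–L55 and (1.25.2) p0011 L36–L46: THE UNIVERSAL ELIMINATION ALGEBRA.**
  «`R̄_b = k[Y₂ − Y₁, …, Y_b − Y₁]^{𝕊_b}` … So `R̄_b = R_b ∩ k[Y₂ − Y₁, …, Y_b − Y₁] (⊂ k[Y₁,…,Y_b])`» and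
  «`R̄_{c₁,…,c_r} = A_{c₁,…,c_r}^{𝕊_{c₁} × ⋯ × 𝕊_{c_r}}` … a graded subring of `k[Y]`»: `univElim blk :=
  diffSubalgebra ⊓ permInvariant (blockPerm blk)`, single block `univElimOne ι k := univElim (const Unit)`
  with `univElimOne_eq : univElimOne = diffSubalgebra ⊓ symmetricSubalgebra` (the printed `R̄_b = R_b ∩
  k[Y_i − Y_j]`). PROVED: graded (`homogeneousComponent_mem_univElim`, Remark 1.17 p0009 L119–L131 /
  1.11), the homogeneous pieces `univElimPiece blk n` (a `k`-submodule) with `one_mem_univElimPiece_zero`,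
  `mul_mem_univElimPiece` (pieces multiply into pieces, the weighted-homogeneity bookkeeping of 1.15
  p0009 L1–L12), `C_mem_univElimPiece_zero`, monotonicity in the block structure (`univElim_mono`:
  coarser blocks ⊇, i.e. `R̄_b ⊆ R̄_{c₁,…,c_r}`, p0011 L12–L15 / p0022 L64–L66), and a first
  non-trivial member: `∏_{i ≠ j} (Y_i − Y_j) ∈ R̄_b` (`prod_sub_mem_univElimOne`; p0006 L22–L23 «the
  discriminant of `F(Z)` is an element of this invariant ring» — up to the sign `(−1)^{b(b−1)/2}` this
  product is the discriminant `∏_{i<j} (Y_i − Y_j)²`).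

Deliberately NOT typed here: the generating systems `G_{b,i}` / `H_{F_b}` (Def. 1.21, Prop. 1.23:
`R̄_b` is the integral closure of `H_{F_b}`), Theorem 1.16 / 1.26 (purely ramified locus; multiplicity
`b` ⇒ `ν_S(G_{b,i}(a)) ≥ n_i`), Cor. 1.10 (`R̄_b = k[F_b^{(1)}(Y₁),…,F_b^{(b−1)}(Y₁)] ∩ k[s]`) — theorems of
the source, to be vendored as named facts only on a consumer's request (campaign FACT desk rule).

## References

* O. E. Villamayor U., Adv. Math. 213 (2007) 687–733 = arXiv:math/0606796, §1 (1.5, Def. 1.2, Remark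
  1.6, 1.11, 1.15, 1.24–1.25, Remark 1.17). [Villamayor2007]
* A. Bravo, O. E. Villamayor U., Adv. Math. 224 (2010) 1349–1418 = arXiv:0807.4308, §2.7–§2.9 (the same
  universal algebra, used for the β-elimination algebra `R_{G,β}`). [BravoVillamayor2010]
-/

noncomputable section

open scoped Polynomial

namespace Literature.AlgebraicGeometry.Villamayor2007

open MvPolynomial

universe u v w

variable (ι : Type u) (k : Type v) [CommRing k]

/-! ## §1.5: the universal monic polynomial of degree `b = #ι` -/

/-- **The universal (generic) monic polynomial of degree `b`** [Villamayor 2007, §1.5 p0007 L8–L16]: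
«`F_b(Z) = (Z − Y₁)·(Z − Y₂)⋯(Z − Y_b) ∈ k[Y₁,…,Y_b][Z]`, the generic polynomial of degree `b` … every monic
polynomial of degree `b`, say `f(Z) = Z^b + a₁Z^{b−1} + … + a_b ∈ S[Z]`, over a `k`-algebra `S`, is obtained
from `F_b(Z) ∈ R_b[Z]` by a unique morphism `R_b → S`». Variables indexed by a finite type `ι`
(`b = Fintype.card ι`), coefficients in `k[Y_i ; i ∈ ι] = MvPolynomial ι k`. [cite: Villamayor2007, §1.5] -/
def univMonic [Fintype ι] : (MvPolynomial ι k)[X] :=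
  ∏ i : ι, (Polynomial.X - Polynomial.C (X i))

variable {ι k}

/-- `F_b(Z)` is monic («the universal monic polynomial of degree `b`», p0006 L15).
[cite: Villamayor2007, §1.5] -/
theorem univMonic_monic [Fintype ι] : (univMonic ι k).Monic :=
  Polynomial.monic_prod_of_monic _ _ fun i _ => Polynomial.monic_X_sub_C (X i)

/-- `F_b(Z)` has degree `b = #ι` (p0007 L10–L11 «the generic polynomial of degree `b`»).
[cite: Villamayor2007, §1.5] -/
theorem natDegree_univMonic [Fintype ι] [Nontrivial k] :
    (univMonic ι k).natDegree = Fintype.card ι := by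
  rw [univMonic, Polynomial.natDegree_prod_of_monic _ _ fun i _ => Polynomial.monic_X_sub_C (X i)]
  simp

/-- The universal monic polynomial as a multiset product over the variables (bridge to Mathlib's Vieta
lemmas). [cite: Villamayor2007, §1.5] -/
theorem univMonic_eq_multiset_prod [Fintype ι] :
    univMonic ι k = ((Finset.univ : Finset ι).val.map fun i => Polynomial.X - Polynomial.C (X i)).prod := by
  rw [univMonic, Finset.prod_eq_multiset_prod]

/-- **Vieta expansion of the universal polynomial** [Villamayor 2007, §1.5 p0007 L13]: «`F_b(Z) = Z^b −
s_{b,1}Z^{b−1} + … + (−1)^b s_{b,b}`», i.e. the coefficient of `Z^j` (`j ≤ b`) is `(−1)^{b−j} s_{b,b−j}` with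
`s_{b,i}` = Mathlib's elementary symmetric polynomial `MvPolynomial.esymm ι k i`.
[cite: Villamayor2007, §1.5 Eq. p0007 L13] -/
theorem coeff_univMonic [Fintype ι] {j : ℕ} (hj : j ≤ Fintype.card ι) :
    (univMonic ι k).coeff j = (-1) ^ (Fintype.card ι - j) * esymm ι k (Fintype.card ι - j) := by
  have h := Multiset.prod_X_sub_C_coeff ((Finset.univ : Finset ι).val.map (X : ι → MvPolynomial ι k))
    (k := j) (by simpa using hj)
  rw [Multiset.map_map] at h
  rw [univMonic_eq_multiset_prod, Function.comp_def] at *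
  rw [h, esymm_eq_multiset_esymm]
  simp

/-! ## Def. 1.2: `Tay` and the operators `Δ^r` = Mathlib's `taylor` / `hasseDeriv` -/

/-- **The operators `Δ^r`** [Villamayor 2007, Def. 1.2 p0006 L54–L65]: «`Tay : S[Z] → S[Z,T]`, `Tay(Z) =
Z + T` … `Tay(F(Z)) = Σ Δ^r(F(Z)) T^r` … The `Δ^r` are differential operators of order `r`. These are
`S`-linear operators». In Mathlib `Δ^r` IS the Hasse derivative `Polynomial.hasseDeriv r` and `Tay` at a
point `s ∈ S` is `Polynomial.taylor s` (`Polynomial.taylor_coeff : (taylor s f).coeff r =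
(hasseDeriv r f).eval s`); this `abbrev` only fixes the printed name. [cite: Villamayor2007, Def. 1.2] -/
abbrev deltaOp {S : Type w} [CommRing S] (r : ℕ) : S[X] →ₗ[S] S[X] := Polynomial.hasseDeriv r

/-- Def. 1.2, printed sanity value «`Δ^n(Z^n) = 1`» (p0006 L65). [cite: Villamayor2007, Def. 1.2] -/
theorem deltaOp_X_pow_self {S : Type w} [CommRing S] (n : ℕ) :
    deltaOp n ((Polynomial.X : S[X]) ^ n) = 1 := by
  rw [deltaOp, Polynomial.X_pow_eq_monomial, Polynomial.hasseDeriv_monomial]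
  simp

/-- Def. 1.2, printed sanity value «`Δ^r(Z^n) = 0` for `r > n`» (p0006 L65). [cite: Villamayor2007, Def. 1.2] -/
theorem deltaOp_X_pow_of_lt {S : Type w} [CommRing S] {r n : ℕ} (h : n < r) :
    deltaOp r ((Polynomial.X : S[X]) ^ n) = 0 :=
  Polynomial.hasseDeriv_eq_zero_of_lt_natDegree _ r ((Polynomial.natDegree_X_pow_le n).trans_lt h)

/-- `Tay(f)(T)` at `s`: the coefficient of `T^r` in `f(s + T)` is `Δ^r(f)(s)` — the printed defining identity
of Def. 1.2 (p0006 L57–L62), which in Mathlib is `Polynomial.taylor_coeff`. [cite: Villamayor2007, Def. 1.2] -/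
theorem taylor_coeff_eq_deltaOp_eval {S : Type w} [CommRing S] (f : S[X]) (s : S) (r : ℕ) :
    (Polynomial.taylor s f).coeff r = (deltaOp r f).eval s :=
  Polynomial.taylor_coeff s f r

variable (ι k) in
/-- **`F_b^{(e)}(Z) := Δ^{(e)}(F_b(Z))`** [Villamayor 2007, 1.7 p0008 L1–L4, Remark 1.8 p0008 L21–L27]: the
Hasse derivatives of the universal polynomial («the coefficients of this polynomial in the variable `T`
are the symmetric polynomials evaluated on the elements `Z − Y_j`», Eq. (1.8.1): `F_b^{(e)}(Z) =
(−1)^{b−e} s_{b,b−e}(Z − Y₁,…,Z − Y_b)` — that identity is not proved here). [cite: Villamayor2007, 1.7] -/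
def univMonicDelta [Fintype ι] (e : ℕ) : (MvPolynomial ι k)[X] := deltaOp e (univMonic ι k)

/-- `F_b^{(0)} = F_b` (`Δ^0 = id`). [cite: Villamayor2007, 1.7] -/
theorem univMonicDelta_zero [Fintype ι] : univMonicDelta ι k 0 = univMonic ι k := by
  simp [univMonicDelta, deltaOp]

/-! ## Permutation groups acting on `k[Y]`: invariant subalgebras and block (Young) subgroups -/

variable (ι k) in
/-- **Invariants of a permutation group** [Villamayor 2007, §1.5 p0007 L18–L23 «`𝕊_b` … acting on
`k[Y₁,…,Y_b]` in the usual manner, so that `R_b = k[Y₁,…,Y_b]^{𝕊_b}`»; 1.24 p0011 L4–L12 «the permutation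
groups `𝕊_{c_i}` and `𝕊_b` act linearly … which asserts that the invariant rings are graded»]: for a subgroup
`G ≤ 𝕊_ι = Equiv.Perm ι`, the `k`-subalgebra `k[Y]^G = {p ; rename σ p = p for all σ ∈ G}`. For `G = ⊤` this
is Mathlib's `MvPolynomial.symmetricSubalgebra` (`permInvariant_top`). [cite: Villamayor2007, §1.5 Eq. (1.5.1)] -/
def permInvariant (G : Subgroup (Equiv.Perm ι)) : Subalgebra k (MvPolynomial ι k) where
  carrier := {p | ∀ σ ∈ G, rename σ p = p}
  mul_mem' {p q} hp hq σ hσ := by rw [map_mul, hp σ hσ, hq σ hσ]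
  add_mem' {p q} hp hq σ hσ := by rw [map_add, hp σ hσ, hq σ hσ]
  algebraMap_mem' r σ _ := by simp

/-- Unfolding of `permInvariant`. [cite: Villamayor2007, §1.5 Eq. (1.5.1)] -/
theorem mem_permInvariant_iff {G : Subgroup (Equiv.Perm ι)} {p : MvPolynomial ι k} :
    p ∈ permInvariant ι k G ↔ ∀ σ ∈ G, rename σ p = p := Iff.rfl

/-- «`R_b = k[s_{b,1},…,s_{b,b}] = k[Y₁,…,Y_b]^{𝕊_b}`» (Eq. (1.5.1) p0007 L21–L23): the invariants of the full
symmetric group are Mathlib's symmetric subalgebra. [cite: Villamayor2007, §1.5 Eq. (1.5.1)] -/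
theorem permInvariant_top : permInvariant ι k ⊤ = symmetricSubalgebra ι k := by
  ext p
  simp only [mem_permInvariant_iff, Subgroup.mem_top, forall_true_left, mem_symmetricSubalgebra]
  rfl

/-- A bigger group has fewer invariants («the inclusion of finite groups … provides a finite extension of
invariant rings», 1.24 p0011 L12–L15; finiteness not proved here). [cite: Villamayor2007, 1.24] -/
theorem permInvariant_anti {G H : Subgroup (Equiv.Perm ι)} (h : G ≤ H) :
    permInvariant ι k H ≤ permInvariant ι k G :=
  fun _ hp σ hσ => hp σ (h hσ)

/-- `R_b = k[Y]^{𝕊_b} ⊆ k[Y]^G` for every `G ≤ 𝕊_b` (1.25 p0011 L21–L25, the case `G = 𝕊_{c₁} × ⋯ × 𝕊_{c_r}`).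
[cite: Villamayor2007, 1.25] -/
theorem symmetricSubalgebra_le_permInvariant (G : Subgroup (Equiv.Perm ι)) :
    symmetricSubalgebra ι k ≤ permInvariant ι k G := by
  rw [← permInvariant_top]
  exact permInvariant_anti le_top

/-- The invariant subalgebras are GRADED [Villamayor 2007, 1.24 p0011 L8–L12 «act linearly … the invariant
rings are graded»; Remark 1.17 p0009 L119–L131]: every homogeneous component of an invariant polynomial is
invariant (a permutation of the variables commutes with taking homogeneous components, Mathlib
`MvPolynomial.rename_homogeneousComponent`). [cite: Villamayor2007, 1.24 p0011 L8–L12] -/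
theorem homogeneousComponent_mem_permInvariant {G : Subgroup (Equiv.Perm ι)} {p : MvPolynomial ι k}
    (hp : p ∈ permInvariant ι k G) (n : ℕ) : homogeneousComponent n p ∈ permInvariant ι k G := by
  intro σ hσ
  rw [rename_homogeneousComponent, hp σ hσ]

variable (ι) in
/-- **Block (Young) subgroup** [Villamayor 2007, 1.24–1.25 p0011 L1–L7]: «identify
`k[Y^{(1)}_1,…,Y^{(1)}_{c₁},…,Y^{(r)}_1,…,Y^{(r)}_{c_r}]` with `k[Y₁,…,Y_b]` … there is an inclusion
`𝕊_{c₁} × 𝕊_{c₂} × ⋯ × 𝕊_{c_r}` in `𝕊_b`»: for a block map `blk : ι → β` (variable `i` lies in block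
`blk i`), the permutations of `ι` preserving every block. One block (`blk` constant) is all of `𝕊_ι`
(`blockPerm_const`). [cite: Villamayor2007, 1.24–1.25] -/
def blockPerm {β : Type w} (blk : ι → β) : Subgroup (Equiv.Perm ι) where
  carrier := {σ | ∀ i, blk (σ i) = blk i}
  mul_mem' {σ τ} hσ hτ i := by rw [Equiv.Perm.mul_apply, hσ, hτ]
  one_mem' i := rfl
  inv_mem' {σ} hσ i := by
    have h := hσ (σ.symm i)
    rw [Equiv.apply_symm_apply] at h
    exact h.symm

/-- Unfolding of `blockPerm`. [cite: Villamayor2007, 1.24–1.25] -/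
theorem mem_blockPerm_iff {β : Type w} {blk : ι → β} {σ : Equiv.Perm ι} :
    σ ∈ blockPerm ι blk ↔ ∀ i, blk (σ i) = blk i := Iff.rfl

/-- One block: `𝕊_{c₁} = 𝕊_b` when `r = 1`, `c₁ = b` (the §1.5 case of 1.24). [cite: Villamayor2007, 1.24–1.25] -/
theorem blockPerm_const {β : Type w} (b : β) : blockPerm ι (fun _ : ι => b) = ⊤ :=
  top_unique fun _ _ _ => rfl

/-- Refining the blocks shrinks the group: if `blk' = g ∘ blk` (the blocks of `blk'` are unions of blocks of
`blk`) then `blockPerm blk ≤ blockPerm blk'` — the inclusion `𝕊_{c₁} × ⋯ × 𝕊_{c_r} ⊂ 𝕊_b` of 1.24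
(p0011 L5–L7). [cite: Villamayor2007, 1.24–1.25] -/
theorem blockPerm_mono {β : Type w} {γ : Type*} (blk : ι → β) (g : β → γ) :
    blockPerm ι blk ≤ blockPerm ι (g ∘ blk) :=
  fun σ hσ i => by simp only [Function.comp_apply, hσ i]

/-! ## The algebra of differences `k[Y_i − Y_j]` -/

variable (ι k) in
/-- **The algebra generated by all differences** [Villamayor 2007, §1 p0006 L17–L20 «the `k`-algebra
generated by all differences `Y_j − Y_k`»; p0007 L42–L46 «the subring `k[Y₂ − Y₁,…,Y_b − Y₁] = k[Z_{i,j}]`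
where `Z_{i,j} = Y_i − Y_j`, `1 ≤ i,j ≤ b`»; = `A_{c₁,…,c_r}` of (1.25.1) p0011 L30–L33, the same ring for
every block structure]: `Algebra.adjoin k {Y_i − Y_j ; i, j ∈ ι} ⊂ k[Y]`. [cite: Villamayor2007, (1.5.2)] -/
def diffSubalgebra : Subalgebra k (MvPolynomial ι k) :=
  Algebra.adjoin k (Set.range fun ij : ι × ι => (X ij.1 - X ij.2 : MvPolynomial ι k))

/-- `Z_{i,j} = Y_i − Y_j ∈ k[Z_{i,j}]` (p0007 L44–L46). [cite: Villamayor2007, (1.5.2)] -/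
theorem X_sub_X_mem_diffSubalgebra (i j : ι) : (X i - X j : MvPolynomial ι k) ∈ diffSubalgebra ι k :=
  Algebra.subset_adjoin ⟨(i, j), rfl⟩

/-- «the action of `𝕊_b` on `k[Y₁,…,Y_b]` restricts to an action on the subring `k[Y₂ − Y₁,…,Y_b − Y₁]`»
(p0007 L42–L44): the difference algebra is stable under every permutation (indeed every renaming) of the
variables. [cite: Villamayor2007, (1.5.2) p0007 L42–L44] -/
theorem rename_mem_diffSubalgebra (σ : ι → ι) {p : MvPolynomial ι k} (hp : p ∈ diffSubalgebra ι k) :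
    rename σ p ∈ diffSubalgebra ι k := by
  have hmap : (diffSubalgebra ι k).map (rename σ) ≤ diffSubalgebra ι k := by
    rw [diffSubalgebra, AlgHom.map_adjoin]
    refine Algebra.adjoin_mono ?_
    rintro _ ⟨_, ⟨⟨i, j⟩, rfl⟩, rfl⟩
    exact ⟨(σ i, σ j), by simp⟩
  exact hmap ⟨p, hp, rfl⟩

/-- Every generator `Y_i − Y_j` is homogeneous of degree `1` (1.11 p0008 L68 «graded as subring of `k[Y₁,…,Y_b]`
with the usual grade»). [cite: Villamayor2007, 1.11] -/
theorem isHomogeneous_X_sub_X (i j : ι) : ((X i - X j : MvPolynomial ι k)).IsHomogeneous 1 :=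
  (isHomogeneous_X k i).sub (isHomogeneous_X k j)

/-- A subalgebra of `k[Y]` generated by homogeneous elements is graded: it is closed under taking
homogeneous components (Remark 1.17 p0009 L123–L124 «A subring of this ring is graded when it is generated
by homogeneous elements»). [cite: Villamayor2007, Remark 1.17] -/
theorem homogeneousComponent_mem_adjoin_of_homogeneous {s : Set (MvPolynomial ι k)}
    (hs : ∀ x ∈ s, ∃ d, x.IsHomogeneous d) {p : MvPolynomial ι k} (hp : p ∈ Algebra.adjoin k s) (n : ℕ) :
    homogeneousComponent n p ∈ Algebra.adjoin k s := by
  -- every monomial in the generators is homogeneous of some degree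
  have hmon : ∀ x ∈ Submonoid.closure s, ∃ d, x.IsHomogeneous d := by
    intro x hx
    induction hx using Submonoid.closure_induction with
    | mem x hx => exact hs x hx
    | one => exact ⟨0, isHomogeneous_one ι k⟩
    | mul x y _ _ hx hy =>
      obtain ⟨d, hd⟩ := hx
      obtain ⟨e, he⟩ := hy
      exact ⟨d + e, hd.mul he⟩
  -- the subalgebra is the `k`-span of those monomials
  have hspan : p ∈ Submodule.span k (Submonoid.closure s : Set (MvPolynomial ι k)) := by
    rw [← Algebra.adjoin_eq_span]; exact hp
  clear hp
  revert n
  induction hspan using Submodule.span_induction with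
  | mem x hx =>
    intro n
    obtain ⟨d, hd⟩ := hmon x hx
    rw [homogeneousComponent_of_mem hd]
    split_ifs
    · exact (Submonoid.closure_le (S := (Algebra.adjoin k s).toSubmonoid)).mpr Algebra.subset_adjoin hx
    · exact zero_mem _
  | zero => intro n; simp
  | add x y _ _ hx hy => intro n; rw [map_add]; exact add_mem (hx n) (hy n)
  | smul c x _ hx => intro n; rw [map_smul]; exact Subalgebra.smul_mem _ (hx n) c

/-- The difference algebra is GRADED [Villamayor 2007, 1.11 p0008 L68–L72 «`k[Y₂ − Y₁,…,Y_b − Y₁]` graded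
as subring of `k[Y₁,…,Y_b]` with the usual grade»; 1.25 p0011 L36 «preserves the usual degrees»]: closed
under homogeneous components. [cite: Villamayor2007, 1.11] -/
theorem homogeneousComponent_mem_diffSubalgebra {p : MvPolynomial ι k} (hp : p ∈ diffSubalgebra ι k)
    (n : ℕ) : homogeneousComponent n p ∈ diffSubalgebra ι k :=
  homogeneousComponent_mem_adjoin_of_homogeneous
    (by rintro _ ⟨⟨i, j⟩, rfl⟩; exact ⟨1, isHomogeneous_X_sub_X i j⟩) hp n

/-! ## (1.5.2) / (1.25.2): the universal elimination algebras `R̄_b` and `R̄_{c₁,…,c_r}` -/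

variable (ι k) in
/-- **The universal elimination algebra of a block structure** [Villamayor 2007, (1.25.2) p0011 L36–L46]:
«The finite group `𝕊_{c₁} × 𝕊_{c₂} × ⋯ × 𝕊_{c_r}` also acts on the graded subalgebra `A_{c₁,…,c_r} =
k[Y^{(1)}_2 − Y^{(1)}_1, …, Y^{(r)}_{c_r} − Y^{(1)}_1]` in a way that preserves the usual degrees. Therefore,
the ring of invariants, say `R̄_{c₁,…,c_r} = A_{c₁,…,c_r}^{𝕊_{c₁} × ⋯ × 𝕊_{c_r}}` is a finitely generated
`k`-algebra, and a graded subring of `k[Y]`». Blocks are the fibres of `blk : ι → β` (block `i` has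
`c_i = #blk⁻¹(i)` variables). For ONE block this is `R̄_b` (`univElimOne`, (1.5.2)). Finite generation is
not proved here. [cite: Villamayor2007, (1.25.2)] -/
def univElim {β : Type w} (blk : ι → β) : Subalgebra k (MvPolynomial ι k) :=
  diffSubalgebra ι k ⊓ permInvariant ι k (blockPerm ι blk)

variable (ι k) in
/-- **The universal elimination algebra `R̄_b`** [Villamayor 2007, (1.5.2) p0007 L47–L55]: «`R̄_b =
k[Y₂ − Y₁, …, Y_b − Y₁]^{𝕊_b}`, the subring of invariants by this action. So `R̄_b = R_b ∩
k[Y₂ − Y₁, …, Y_b − Y₁] (⊂ k[Y₁,…,Y_b])`» — «Elements of `R̄_b` are elements in `R_b`, that provide, for every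
monic polynomial `f(Z) ∈ S[Z]` of degree `b`, equations on the coefficients which are independent of changes
of the form `Z₁ = Z − s`, `s ∈ S`» (p0007 L57–L60). The one-block case of `univElim`.
[cite: Villamayor2007, (1.5.2)] -/
def univElimOne : Subalgebra k (MvPolynomial ι k) :=
  univElim ι k (fun _ : ι => ())

/-- Unfolding: `p ∈ R̄_{blk}` iff `p` is a polynomial in the differences fixed by the block permutations
((1.25.2) p0011 L39–L41). [cite: Villamayor2007, (1.25.2)] -/
theorem mem_univElim_iff {β : Type w} {blk : ι → β} {p : MvPolynomial ι k} :
    p ∈ univElim ι k blk ↔ p ∈ diffSubalgebra ι k ∧ ∀ σ ∈ blockPerm ι blk, rename σ p = p :=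
  Iff.rfl

/-- (1.5.2), second form: «`R̄_b = R_b ∩ k[Y₂ − Y₁,…,Y_b − Y₁]`» (p0007 L54–L55) with `R_b` = Mathlib's symmetric
subalgebra. [cite: Villamayor2007, (1.5.2)] -/
theorem univElimOne_eq : univElimOne ι k = diffSubalgebra ι k ⊓ symmetricSubalgebra ι k := by
  rw [univElimOne, univElim, blockPerm_const, permInvariant_top]

/-- Unfolding of `R̄_b = R_b ∩ k[Y_i − Y_j]` (p0007 L54–L55). [cite: Villamayor2007, (1.5.2)] -/
theorem mem_univElimOne_iff {p : MvPolynomial ι k} :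
    p ∈ univElimOne ι k ↔ p ∈ diffSubalgebra ι k ∧ p.IsSymmetric := by
  rw [univElimOne_eq]
  exact Iff.rfl

/-- `R̄_b ⊆ R_b`: universal elimination invariants are symmetric polynomials (p0007 L57 «Elements of `R̄_b`,
are elements in `R_b`»). [cite: Villamayor2007, (1.5.2) p0007 L57] -/
theorem univElimOne_le_symmetricSubalgebra : univElimOne ι k ≤ symmetricSubalgebra ι k := by
  rw [univElimOne_eq]; exact inf_le_right

/-- `R̄_{c₁,…,c_r} ⊆ A_{c₁,…,c_r}` ((1.25.2): it is the invariant subring OF `A`). [cite: Villamayor2007, (1.25.2)] -/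
theorem univElim_le_diffSubalgebra {β : Type w} (blk : ι → β) : univElim ι k blk ≤ diffSubalgebra ι k :=
  inf_le_left

/-- Coarsening the blocks shrinks the algebra: `R̄_{(g ∘ blk)} ⊆ R̄_{blk}`; in particular `R̄_b ⊆ R̄_{c₁,…,c_r}`
for every block structure (the finite extension of invariant rings of 1.24 p0011 L12–L15; the «natural
inclusion of graded algebras `R̄_{f_{c₁},…,f_{c_r}} ⊃ R̄_{f_{c₂},…,f_{c_r}}`» of Def. 4.10 p0022 L64–L66 is
its specialization). [cite: Villamayor2007, 1.24 p0011 L12–L15] -/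
theorem univElim_mono {β : Type w} {γ : Type*} (blk : ι → β) (g : β → γ) :
    univElim ι k (g ∘ blk) ≤ univElim ι k blk :=
  inf_le_inf_left _ (permInvariant_anti (blockPerm_mono blk g))

/-- `R̄_b ⊆ R̄_{c₁,…,c_r}` for every block structure with `c₁ + ⋯ + c_r = b` (1.24–1.26: «the inclusion
`𝕊_{c₁} × ⋯ × 𝕊_{c_r} ⊂ 𝕊_b` defines a finite extension of invariant rings», p0011 L109–L112).
[cite: Villamayor2007, 1.24 p0011 L12–L15] -/
theorem univElimOne_le_univElim {β : Type w} (blk : ι → β) : univElimOne ι k ≤ univElim ι k blk := by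
  have h := univElim_mono (k := k) blk (fun _ => ())
  exact h

/-- The universal elimination algebras are GRADED subrings of `k[Y]` [Villamayor 2007, 1.11 p0008 L68–L72;
(1.25.2) p0011 L44–L46 «a graded subring»; Remark 1.17 p0009 L119–L131]: closed under homogeneous
components. [cite: Villamayor2007, (1.25.2) p0011 L44–L46] -/
theorem homogeneousComponent_mem_univElim {β : Type w} {blk : ι → β} {p : MvPolynomial ι k}
    (hp : p ∈ univElim ι k blk) (n : ℕ) : homogeneousComponent n p ∈ univElim ι k blk :=
  ⟨homogeneousComponent_mem_diffSubalgebra hp.1 n, homogeneousComponent_mem_permInvariant hp.2 n⟩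

variable (ι k) in
/-- **Homogeneous piece of degree `n` of the universal elimination algebra** [Villamayor 2007, 1.15
p0009 L1–L7 «an homogeneous element `H ∈ R̄_b`, of degree `m` in `k[Y₁,…,Y_b]`»; 1.11 «`R̄_b =
k[G_{b,1},…,G_{b,r_b}]`, where the generators `G_{b,i}` are homogeneous polynomials»]: the `k`-submodule
`[R̄]_n = R̄ ∩ k[Y]_n` of members homogeneous of degree `n` (Mathlib `MvPolynomial.homogeneousSubmodule`).
These pieces are what the specialization of Def. 1.42 sends to the ideals `I_n ⊂ S`.
[cite: Villamayor2007, 1.15] -/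
def univElimPiece {β : Type w} (blk : ι → β) (n : ℕ) : Submodule k (MvPolynomial ι k) :=
  Subalgebra.toSubmodule (univElim ι k blk) ⊓ homogeneousSubmodule ι k n

/-- Unfolding of the degree-`n` piece. [cite: Villamayor2007, 1.15] -/
theorem mem_univElimPiece_iff {β : Type w} {blk : ι → β} {n : ℕ} {p : MvPolynomial ι k} :
    p ∈ univElimPiece ι k blk n ↔ p ∈ univElim ι k blk ∧ p.IsHomogeneous n := Iff.rfl

/-- The degree-`n` component of a member of `R̄` lies in the degree-`n` piece `[R̄]_n` (gradedness, 1.11 /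
(1.25.2)). [cite: Villamayor2007, 1.15] -/
theorem homogeneousComponent_mem_univElimPiece {β : Type w} {blk : ι → β} {p : MvPolynomial ι k}
    (hp : p ∈ univElim ι k blk) (n : ℕ) : homogeneousComponent n p ∈ univElimPiece ι k blk n :=
  ⟨homogeneousComponent_mem_univElim hp n, homogeneousComponent_isHomogeneous n p⟩

/-- `[R̄]_0 ∋ 1`. [cite: Villamayor2007, 1.15] -/
theorem one_mem_univElimPiece_zero {β : Type w} (blk : ι → β) :
    (1 : MvPolynomial ι k) ∈ univElimPiece ι k blk 0 :=
  ⟨(univElim ι k blk).one_mem, isHomogeneous_one ι k⟩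

/-- Constants lie in degree `0`: `k ⊂ [R̄]_0`. [cite: Villamayor2007, 1.15] -/
theorem C_mem_univElimPiece_zero {β : Type w} (blk : ι → β) (r : k) :
    (C r : MvPolynomial ι k) ∈ univElimPiece ι k blk 0 :=
  ⟨Subalgebra.algebraMap_mem _ r, isHomogeneous_C ι r⟩

/-- Pieces multiply into pieces: `[R̄]_m · [R̄]_n ⊆ [R̄]_{m+n}` (the weighted-homogeneity bookkeeping of 1.15
p0009 L1–L12). [cite: Villamayor2007, 1.15] -/
theorem mul_mem_univElimPiece {β : Type w} {blk : ι → β} {m n : ℕ} {p q : MvPolynomial ι k}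
    (hp : p ∈ univElimPiece ι k blk m) (hq : q ∈ univElimPiece ι k blk n) :
    p * q ∈ univElimPiece ι k blk (m + n) :=
  ⟨(univElim ι k blk).mul_mem hp.1 hq.1, hp.2.mul hq.2⟩

/-- A member of `R̄` is the (finite) sum of its homogeneous pieces, each of which lies in `R̄` — the graded
decomposition «`R̄_b` is a graded subring of `R_b`» (p0007 L62–L63) in Mathlib's `homogeneousComponent`
language. [cite: Villamayor2007, (1.5.2) p0007 L62–L63] -/
theorem sum_homogeneousComponent_of_mem_univElim {β : Type w} {blk : ι → β} {p : MvPolynomial ι k}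
    (_hp : p ∈ univElim ι k blk) :
    ∑ i ∈ Finset.range (p.totalDegree + 1), homogeneousComponent i p = p :=
  sum_homogeneousComponent p

/-! ## First members: symmetric functions of the differences (the discriminant) -/

/-- The product of ALL ordered differences `∏_{i ≠ j} (Y_i − Y_j)` lies in `R̄_b` — it is a polynomial in
the differences and it is symmetric; up to the sign `(−1)^{b(b−1)/2}` it is the discriminant of `F_b(Z)`
(p0006 L22–L23 «Note that the discriminant of `F(Z)` is an element of this invariant ring»).
[cite: Villamayor2007, §1 p0006 L22–L23] -/
theorem prod_sub_mem_univElimOne [Fintype ι] [DecidableEq ι] :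
    (∏ ij ∈ (Finset.univ : Finset (ι × ι)).filter (fun ij => ij.1 ≠ ij.2),
      (X ij.1 - X ij.2 : MvPolynomial ι k)) ∈ univElimOne ι k := by
  rw [mem_univElimOne_iff]
  refine ⟨prod_mem fun ij _ => X_sub_X_mem_diffSubalgebra ij.1 ij.2, ?_⟩
  intro σ
  rw [map_prod]
  simp only [map_sub, rename_X]
  -- reindex the product along the bijection `(i, j) ↦ (σ i, σ j)` of the off-diagonal pairs
  refine Finset.prod_nbij (fun ij => (σ ij.1, σ ij.2)) ?_ ?_ ?_ ?_
  · intro ij hij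
    simp only [Finset.mem_filter, Finset.mem_univ, true_and] at hij ⊢
    exact fun h => hij (σ.injective h)
  · intro ij _ ij' _ h
    simp only [Prod.mk.injEq] at h
    exact Prod.ext (σ.injective h.1) (σ.injective h.2)
  · intro ij hij
    simp only [Finset.coe_filter, Finset.mem_univ, true_and, Set.mem_setOf_eq] at hij
    refine ⟨(σ.symm ij.1, σ.symm ij.2), ?_, ?_⟩
    · simp only [Finset.coe_filter, Finset.mem_univ, true_and, Set.mem_setOf_eq]
      exact fun h => hij (σ.symm.injective h)
    · simp
  · intro ij _
    rfl

/-! ## Translation invariance (the reason for the differences), §1.5 p0007 L50–L60 -/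

/-- **Translation invariance of the difference algebra** [Villamayor 2007, §1.1 p0006 L50–L52 «changes of
variables of the form `Z₁ = Z − s`, `s ∈ S` do not affect the finite extension»; §1.5 p0007 L57–L60 «Elements of
`R̄_b` … provide, for every monic polynomial `f(Z) ∈ S[Z]` of degree `b`, equations on the coefficients which are
independent of changes of the form `Z₁ = Z − s`, `s ∈ S`»], at the level of ROOTS: evaluating a polynomial in the
differences `Y_i − Y_j` at a family `y` of elements of a `k`-algebra `A` gives the same value as at the translated
family `y + c`, for every `c ∈ A`. [cite: Villamayor2007, (1.5.2) p0007 L57–L60] -/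
theorem aeval_add_const_of_mem_diffSubalgebra {A : Type w} [CommRing A] [Algebra k A] (y : ι → A) (c : A)
    {G : MvPolynomial ι k} (hG : G ∈ diffSubalgebra ι k) :
    aeval (fun i => y i + c) G = aeval y G := by
  induction hG using Algebra.adjoin_induction with
  | mem x hx =>
    obtain ⟨⟨i, j⟩, rfl⟩ := hx
    simp only [map_sub, aeval_X]
    ring
  | algebraMap r => simp
  | add x y' _ _ hx hy => rw [map_add, map_add, hx, hy]
  | mul x y' _ _ hx hy => rw [map_mul, map_mul, hx, hy]

/-- Translation invariance for the universal elimination algebras `R̄_{blk}` (in particular `R̄_b`): members take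
the same value at `y` and at `y + c`. [cite: Villamayor2007, (1.5.2) p0007 L57–L60] -/
theorem aeval_add_const_of_mem_univElim {β : Type*} {blk : ι → β} {A : Type w} [CommRing A] [Algebra k A]
    (y : ι → A) (c : A) {G : MvPolynomial ι k} (hG : G ∈ univElim ι k blk) :
    aeval (fun i => y i + c) G = aeval y G :=
  aeval_add_const_of_mem_diffSubalgebra y c hG.1

/-- The universal form: under the `k`-algebra endomorphism `Y_i ↦ Y_i + q` of `k[Y]` (`q` any polynomial, e.g. a
fresh variable after enlarging `ι`), every element of `k[Y_i − Y_j]` is fixed. [cite: Villamayor2007, (1.5.2) p0007 L57–L60] -/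
theorem aeval_X_add_of_mem_diffSubalgebra (q : MvPolynomial ι k) {G : MvPolynomial ι k}
    (hG : G ∈ diffSubalgebra ι k) : aeval (fun i => X i + q) G = G := by
  rw [aeval_add_const_of_mem_diffSubalgebra X q hG, aeval_X_left, AlgHom.id_apply]

end Literature.AlgebraicGeometry.Villamayor2007

end
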